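import Summits.AtomisticToContinuum.HydrodynamicLimit.Theorems.InformationPercolationEngineChaosClosesEulerPressureValueM
import Summits.AtomisticToContinuum.HydrodynamicLimit.Theorems.InformationPercolationEngineChaosClosesEulerStressIsotropyF
import HarnessLib

/-!
# Collisional pressure value in band (crux `ChaosClosesEuler`, stmt-AtomisticToContinuum-15141, line `Sketch`,
# stub `stub_pressureValueOfEnskog`) — helper N: bridging and the tolerance budget

WHAT. (i) The collision functional of the statement (one `finsum` over the collision times with the mark
`g(σ³ρ_r(xᵢ)) |⟪v⁻ᵢ − v⁻ⱼ, n̂⟫| Σ_kl a_kl(s, xᵢ) n̂ₖ n̂ₗ`) is, along a good orbit, the `Σ_kl` of the tree's collision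
sums `K_t[a_kl g |⟪·,·⟫| n̂ₖn̂ₗ]` (`pressureSum_eq`); the quadratic collision-moment functional of `CollisionMomentUI`
is the collision sum of the mark `(1 + |v|² + |w|²) 1{L < |v|² + |w|²}` (elastic reflection conserves
`|v|² + |w|²`, `cmuiSum_eq`); collision sums only see the weight on `[0, τ]` and the cutoff on `[0, ∞)`
(`collisionSum_congr`); the clamped coefficient `a(clamp s, x)` is continuous, globally bounded and globally
uniformly continuous and agrees with `a` on the window (`clampCoeff_facts`).
(ii) `budget_le` — the tolerance bookkeeping: with the choices of helper O the bound of `pathwise_core` is `≤ η`.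

References: elementary.
-/

noncomputable section

namespace Summit.AtomisticToContinuum.HydrodynamicLimit.Theorems.ChaosClosesEulerPressureValue

open scoped BigOperators Topology Classical MeasureTheory ENNReal InnerProductSpace
open Filter Set MeasureTheory
open Literature.MathematicalPhysics.KineticTheory
open Literature.Analysis.FluidPDE
open Summit.AtomisticToContinuum.HydrodynamicLimit.Theorems.LocalSecondLawNegative
open Summit.AtomisticToContinuum.HydrodynamicLimit.Theorems.LocalSecondLawLedger
open Summit.AtomisticToContinuum.HydrodynamicLimit.Theorems.LocalSecondLawLedger.L
  (Mmom rhoC_eq_sum momC_apply_eq_sum momC_eq_sum kinC_eq_trace norm_sq_eq_sum)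

/-- The truncated stress mark `𝒯[L,k,l]` (local notation for an explicit lambda). -/
local notation3 "𝒯[" L ", " k ", " l "]" => fun q : V3 × V3 × V3 =>
  min |⟪q.2.1 - q.2.2, q.1⟫_ℝ| (4 * L) * (speedCutoff L ‖q.2.1‖ * speedCutoff L ‖q.2.2‖) * (clip1 (q.1 k) * clip1 (q.1 l))

/-- The dominating mark `ℬ[L]` (local notation for an explicit lambda). -/
local notation3 "ℬ[" L "]" => fun q : V3 × V3 × V3 => 4 * L * (speedCutoff L ‖q.2.1‖ * speedCutoff L ‖q.2.2‖)

section Bridging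

open Function

variable {σ : ℝ} {N : ℕ} (Φ : HardSphereFlow (Torus.geometry (Fin 3)) (hsDiameter σ N) (N + 1)) {z : Phase N}

/-- `mollDensity` is the tree's `rhoC`. [folklore] -/
theorem mollDensity_eq_rhoC' (r : ℝ) (w : Phase N) (x : T3) : mollDensity r w x = rhoC r w x := rfl

/-- **Collision sums only see the weight on `[0, τ] × 𝕋³` and the cutoff on `[0, ∞)`** (`0 ≤ σ`, `0 < r`).
[folklore] -/
theorem collisionSum_congr (hz : z ∈ Φ.good) (hσ : 0 ≤ σ) {r : ℝ} (hr : 0 < r) {τ : ℝ} {χ₁ χ₂ : ℝ × T3 → ℝ}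
    {g₁ g₂ : ℝ → ℝ} (Ξ : V3 × V3 × V3 → ℝ) (hχ : ∀ s ∈ Icc (0 : ℝ) τ, ∀ x, χ₁ (s, x) = χ₂ (s, x))
    (hg : ∀ b, 0 ≤ b → g₁ b = g₂ b) :
    collisionSum σ N Φ τ χ₁ g₁ Ξ r z = collisionSum σ N Φ τ χ₂ g₂ Ξ r z := by
  simp only [collisionSum_eq_sum Φ hz]
  congr 1
  refine Finset.sum_congr rfl fun s hs => Finset.sum_congr rfl fun i _ => Finset.sum_congr rfl fun j _ => ?_
  have hsI : s ∈ Icc (0 : ℝ) τ := ((Set.Finite.mem_toFinset _).1 hs).2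
  rw [hχ s hsI, hg _ (mul_nonneg (pow_nonneg hσ 3) (by rw [mollDensity_eq_rhoC']; exact rhoC_nonneg hr _ _))]

/-- Reordering a fivefold finite sum: `Σ_s Σ_i Σ_j Σ_k Σ_l = Σ_k Σ_l Σ_s Σ_i Σ_j`. [folklore] -/
theorem sum5_comm {α β γ : Type*} (S : Finset α) (I : Finset β) (K : Finset γ) (f : α → β → β → γ → γ → ℝ) :
    ∑ s ∈ S, ∑ i ∈ I, ∑ j ∈ I, ∑ k ∈ K, ∑ l ∈ K, f s i j k l =
      ∑ k ∈ K, ∑ l ∈ K, ∑ s ∈ S, ∑ i ∈ I, ∑ j ∈ I, f s i j k l := by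
  have h1 : ∀ s i, ∑ j ∈ I, ∑ k ∈ K, ∑ l ∈ K, f s i j k l = ∑ k ∈ K, ∑ l ∈ K, ∑ j ∈ I, f s i j k l := by
    intro s i
    rw [Finset.sum_comm]
    exact Finset.sum_congr rfl fun k _ => Finset.sum_comm
  have h2 : ∀ s, ∑ i ∈ I, ∑ k ∈ K, ∑ l ∈ K, ∑ j ∈ I, f s i j k l = ∑ k ∈ K, ∑ l ∈ K, ∑ i ∈ I, ∑ j ∈ I, f s i j k l := by
    intro s
    rw [Finset.sum_comm]
    exact Finset.sum_congr rfl fun k _ => Finset.sum_comm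
  simp_rw [h1, h2]
  rw [Finset.sum_comm]
  exact Finset.sum_congr rfl fun k _ => Finset.sum_comm

/-- **The collision functional of the statement is the `Σ_kl` of collision sums** along a good orbit. [folklore] -/
theorem pressureSum_eq (hz : z ∈ Φ.good) (t r : ℝ) (a : Fin 3 → Fin 3 → ℝ × T3 → ℝ) (g : ℝ → ℝ) :
    hsDiameter σ N / (N + 1 : ℝ) *
      (∑ᶠ (s : ℝ) (_ : s ∈ collisionTimes (Torus.geometry (Fin 3)) (hsDiameter σ N) (fun s => Φ.flow s z) ∩
        Set.Icc 0 t), ∑ i : Fin (N + 1), ∑ j : Fin (N + 1),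
        (if i ≠ j ∧ ‖(Torus.geometry (Fin 3)).sepVec (Φ.flow s z i).1 (Φ.flow s z j).1‖ = hsDiameter σ N then
          g (σ ^ 3 * rhoC r (Φ.flow s z) (Φ.flow s z i).1) *
            |⟪(reflectVel ((Torus.geometry (Fin 3)).sepVec (Φ.flow s z i).1 (Φ.flow s z j).1)
                ((Φ.flow s z i).2, (Φ.flow s z j).2)).1 -
              (reflectVel ((Torus.geometry (Fin 3)).sepVec (Φ.flow s z i).1 (Φ.flow s z j).1)
                ((Φ.flow s z i).2, (Φ.flow s z j).2)).2,
              (hsDiameter σ N)⁻¹ • (Torus.geometry (Fin 3)).sepVec (Φ.flow s z i).1 (Φ.flow s z j).1⟫_ℝ| *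
            ∑ k : Fin 3, ∑ l : Fin 3, a k l (s, (Φ.flow s z i).1) *
              (((hsDiameter σ N)⁻¹ • (Torus.geometry (Fin 3)).sepVec (Φ.flow s z i).1 (Φ.flow s z j).1) k *
                ((hsDiameter σ N)⁻¹ • (Torus.geometry (Fin 3)).sepVec (Φ.flow s z i).1 (Φ.flow s z j).1) l)
        else 0)) =
    ∑ k : Fin 3, ∑ l : Fin 3, collisionSum σ N Φ t (a k l) g (fun q => |⟪q.2.1 - q.2.2, q.1⟫_ℝ| * (q.1 k * q.1 l)) r z := by
  rw [finsum_mem_eq_finite_toFinset_sum _ (finite_collisionTimes_Icc Φ hz t)]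
  simp only [collisionSum_eq_sum Φ hz, mollDensity_eq_rhoC']
  rw [← Finset.sum_congr rfl fun k _ => Finset.mul_sum _ _ _, ← Finset.mul_sum, ← sum5_comm]
  congr 1
  refine Finset.sum_congr rfl fun s _ => Finset.sum_congr rfl fun i _ => Finset.sum_congr rfl fun j _ => ?_
  split_ifs with hc
  · rw [Finset.mul_sum]
    refine Finset.sum_congr rfl fun k _ => ?_
    rw [Finset.mul_sum]
    refine Finset.sum_congr rfl fun l _ => ?_
    ring
  · simp

/-- **The quadratic collision-moment functional is a collision sum**: elastic reflection conserves
`|vᵢ|² + |vⱼ|²`. [folklore] -/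
theorem cmuiSum_eq (τ r L : ℝ) (z : Phase N) :
    hsDiameter σ N / (N + 1 : ℝ) *
      ∑ᶠ (s : ℝ) (_ : s ∈ collisionTimes (Torus.geometry (Fin 3)) (hsDiameter σ N) (fun s => Φ.flow s z) ∩
        Set.Icc 0 τ), ∑ i : Fin (N + 1), ∑ j : Fin (N + 1),
        (if i ≠ j ∧ ‖(Torus.geometry (Fin 3)).sepVec (Φ.flow s z i).1 (Φ.flow s z j).1‖ = hsDiameter σ N then
          (if L < ‖(Φ.flow s z i).2‖ ^ 2 + ‖(Φ.flow s z j).2‖ ^ 2 then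
            1 + ‖(Φ.flow s z i).2‖ ^ 2 + ‖(Φ.flow s z j).2‖ ^ 2 else 0) else 0) =
    collisionSum σ N Φ τ (fun _ => 1) (fun _ => 1)
      (fun q => if L < ‖q.2.1‖ ^ 2 + ‖q.2.2‖ ^ 2 then 1 + ‖q.2.1‖ ^ 2 + ‖q.2.2‖ ^ 2 else 0) r z := by
  dsimp only [Literature.MathematicalPhysics.KineticTheory.collisionSum]
  congr 1
  refine finsum_congr fun s => finsum_congr fun _ => ?_
  refine Finset.sum_congr rfl fun i _ => Finset.sum_congr rfl fun j _ => ?_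
  simp only [one_mul, add_assoc, norm_sq_reflectVel_fst_add_norm_sq_reflectVel_snd]

/-- Monotonicity of a collision sum in a nonnegative mark (nonnegative weight and cutoff, `0 < σ`). [folklore] -/
theorem collisionSum_mark_mono (Φ : HardSphereFlow (Torus.geometry (Fin 3)) (hsDiameter σ N) (N + 1)) {z : Phase N}
    (hz : z ∈ Φ.good) (hσ : 0 < σ) {τ : ℝ} {χ : ℝ × T3 → ℝ} {g : ℝ → ℝ} {Ξ₁ Ξ₂ : V3 × V3 × V3 → ℝ} (r : ℝ)
    (hχ : ∀ s ∈ Icc (0 : ℝ) τ, ∀ x, 0 ≤ χ (s, x)) (hg : ∀ b, 0 ≤ g b) (h0 : ∀ q, 0 ≤ Ξ₁ q)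
    (hle : ∀ q, ‖q.1‖ = 1 → Ξ₁ q ≤ Ξ₂ q) :
    collisionSum σ N Φ τ χ g Ξ₁ r z ≤ collisionSum σ N Φ τ χ g Ξ₂ r z := by
  have h := abs_collisionSum_sub_le Φ hz hσ r (τ := τ) (χ₁ := χ) (χ₂ := fun _ => 0) (χ₃ := χ) (g₁ := g) (g₂ := g)
    (g₃ := g) (Ξ₁ := Ξ₁) (Ξ₂ := Ξ₁) (Ξ₃ := Ξ₂) (fun s hs x b q hq => by
      rw [zero_mul, zero_mul, sub_zero, abs_mul, abs_mul, abs_of_nonneg (hχ s hs x), abs_of_nonneg (hg b),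
        abs_of_nonneg (h0 q)]
      exact mul_le_mul_of_nonneg_left (hle q hq) (mul_nonneg (hχ s hs x) (hg b)))
  have hz0 : collisionSum σ N Φ τ (fun _ => (0 : ℝ)) g Ξ₁ r z = 0 := by
    have := collisionSum_const_mul Φ hz τ 0 (fun _ => (1 : ℝ)) g Ξ₁ r
    simp only [zero_mul] at this
    exact this
  rw [hz0, sub_zero] at h
  exact (le_abs_self _).trans h

end Bridging

section Clamp

/-- The time clamp to `[0, t + 1]` is `1`-Lipschitz. [folklore] -/
theorem abs_clamp_sub_clamp_le (t s t₀ : ℝ) : |min (max s 0) (t + 1) - min (max t₀ 0) (t + 1)| ≤ |s - t₀| :=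
  ((abs_min_sub_min_le_max _ _ _ _).trans (by rw [sub_self, abs_zero]; exact max_le le_rfl (abs_nonneg _))).trans
    (abs_max_sub_max_le_abs _ _ _)

/-- **The clamped coefficient** `ã_kl(s, x) = a_kl(clamp s, x)` (clamp to `[0, t+1]`): continuous, equal to `a` on
`[0, t+1] × 𝕋³`, globally bounded, and globally uniformly continuous with any prescribed tolerance. [folklore] -/
theorem clampCoeff_facts (a : Fin 3 → Fin 3 → ℝ × T3 → ℝ) (hac : ∀ k l, Continuous (a k l)) (t : ℝ) :
    (∀ k l, Continuous fun p : ℝ × T3 => a k l (min (max p.1 0) (t + 1), p.2)) ∧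
    (∀ k l, ∀ s ∈ Icc (0 : ℝ) (t + 1), ∀ x, a k l (min (max s 0) (t + 1), x) = a k l (s, x)) ∧
    (∃ A : ℝ, 0 ≤ A ∧ ∀ k l (p : ℝ × T3), |a k l (min (max p.1 0) (t + 1), p.2)| ≤ A) ∧
    (∀ ω : ℝ, 0 < ω → ∃ d : ℝ, 0 < d ∧ ∀ k l (s t₀ : ℝ) (x x₀ : T3), |s - t₀| < d → Torus.euclidDist x x₀ < d →
      |a k l (min (max t₀ 0) (t + 1), x₀) - a k l (min (max s 0) (t + 1), x)| ≤ ω) := by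
  have hcl : Continuous fun s : ℝ => min (max s 0) (t + 1) := by fun_prop
  have hmem : ∀ s, -1 ≤ t → min (max s 0) (t + 1) ∈ Icc (0 : ℝ) (t + 1) := fun s ht =>
    ⟨le_min (le_max_right _ _) (by linarith), min_le_right _ _⟩
  refine ⟨fun k l => (hac k l).comp ((hcl.comp continuous_fst).prodMk continuous_snd), fun k l s hs x => ?_, ?_, ?_⟩
  · rw [max_eq_left hs.1, min_eq_left hs.2]
  · by_cases ht : -1 ≤ t
    · obtain ⟨A, hA0, hA⟩ := ChaosClosesEulerStressIsotropy.exists_bound_matrix a hac (t + 1)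
      exact ⟨A, hA0, fun k l p => hA k l _ (hmem p.1 ht) p.2⟩
    · -- degenerate window: the clamp is the constant `t + 1`
      push Not at ht
      obtain ⟨A, hA0, hA⟩ := ChaosClosesEulerStressIsotropy.exists_bound_matrix
        (fun k l p => a k l (t + 1, p.2)) (fun k l => (hac k l).comp (continuous_const.prodMk continuous_snd)) 0
      refine ⟨A, hA0, fun k l p => ?_⟩
      have hc : min (max p.1 0) (t + 1) = t + 1 := min_eq_right (by linarith [le_max_right p.1 0])
      rw [hc]
      exact hA k l 0 ⟨le_rfl, le_rfl⟩ p.2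
  · intro ω hω
    have hd : ∀ kl : Fin 3 × Fin 3, ∃ d : ℝ, 0 < d ∧ ∀ s ∈ Icc (min 0 (t + 1)) (t + 1), ∀ t₀ ∈ Icc (min 0 (t + 1)) (t + 1),
        ∀ x x₀ : T3, |s - t₀| < d → Torus.euclidDist x x₀ < d → |a kl.1 kl.2 (t₀, x₀) - a kl.1 kl.2 (s, x)| ≤ ω :=
      fun kl => exists_modulus_spaceTime (hac kl.1 kl.2) _ _ hω
    choose d hd0 hd using hd
    refine ⟨Finset.univ.inf' Finset.univ_nonempty d, (Finset.lt_inf'_iff _).2 fun kl _ => hd0 kl,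
      fun k l s t₀ x x₀ hst hxx => ?_⟩
    have hdk : Finset.univ.inf' Finset.univ_nonempty d ≤ d (k, l) := Finset.inf'_le _ (Finset.mem_univ _)
    have hmem' : ∀ s, min (max s 0) (t + 1) ∈ Icc (min 0 (t + 1)) (t + 1) := fun s =>
      ⟨le_min (min_le_left _ _ |>.trans (le_max_right _ _)) (min_le_right _ _), min_le_right _ _⟩
    exact hd (k, l) _ (hmem' s) _ (hmem' t₀) x x₀ ((abs_clamp_sub_clamp_le t s t₀).trans_lt (hst.trans_le hdk))
      (hxx.trans_le hdk)

end Clamp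

section Budget

/-- **The tolerance budget** of `pathwise_core`: with the tolerances and small parameters chosen as in helper O,
the pathwise bound is `≤ η`. [folklore] -/
theorem budget_le {η t A Gb CgY η₀ K L εC εP εPl ω r θ₁ ρ₁ Θ U κ η' : ℝ} (hη : 0 < η) (ht : 0 ≤ t)
    (hA : 0 ≤ A) (hGb : 0 ≤ Gb) (hCgY : 0 ≤ CgY) (hη₀ : 0 ≤ η₀) (hK : 0 ≤ K) (hr1 : r ≤ 1 / 2)
    (hω : 0 ≤ ω) (hω1 : ω ≤ 1)
    (hεC : εC = η / (10 * (9 * (A * Gb) + 1))) (hεP : εP = η / (10 * (9 * A + 1)))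
    (hεPl : εPl = η / (10 * (18 + 72 * A + 1)))
    (hωb : ω ≤ η / (10 * (18 * (t + 2) * (16 * Real.pi * L ^ 2 * CgY * η₀) + 1)))
    (hωb' : ω ≤ η / (20 * (9 * (CgY * (8 * Real.pi / 5) * η₀ * K * (t + 1)) + 1)))
    (hrb : r ≤ η / (20 * (324 * A * (16 * Real.pi * L ^ 2 * CgY * η₀) + 1)))
    (hrb' : r ≤ η / (20 * (54 * A * (CgY * (8 * Real.pi / 5) * η₀ * K) + 1)))
    (h6 : 45 * (CgY * η₀) * (2 * A) * t * (2 * θ₁ + ρ₁ * Θ + (4 * L ^ 2 / (9 * Θ) + 8 * L ^ 2 / (3 * U ^ 2)) * K) +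
        48 * (CgY * η₀) * (2 * A) * κ + 18 * (2 * A) * η' ≤ η / 10)
    (hκ : κ = η / 10 / (6 * (48 * (CgY * η₀) * (2 * A) + 1))) :
    9 * (A * Gb) * εC +
      9 * (ω * (2 * (εPl + (t + 4 * r) * (16 * Real.pi * L ^ 2 * CgY * η₀))) +
        2 * A * (2 * (εPl + 4 * r * (16 * Real.pi * L ^ 2 * CgY * η₀)) +
          2 * (εPl + 5 * r * (16 * Real.pi * L ^ 2 * CgY * η₀)))) +
      9 * (A * εP) +
      9 * (CgY * (8 * Real.pi / 5) * η₀ * K * (ω * (t + 1) + 6 * A * r)) +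
      120 * Real.pi * A * CgY * η₀ * κ +
      8 * Real.pi / 15 * (45 * (CgY * η₀) * (2 * A) * t *
          (2 * θ₁ + ρ₁ * Θ + (4 * L ^ 2 / (9 * Θ) + 8 * L ^ 2 / (3 * U ^ 2)) * K) +
        48 * (CgY * η₀) * (2 * A) * κ + 18 * (2 * A) * η') ≤ η := by
  have hπ := Real.pi_gt_three
  have hπ4 := Real.pi_lt_four
  set C₁ := 16 * Real.pi * L ^ 2 * CgY * η₀ with hC₁
  have hC₁0 : 0 ≤ C₁ := by rw [hC₁]; positivity
  set C₄ := CgY * (8 * Real.pi / 5) * η₀ * K with hC₄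
  have hC₄0 : 0 ≤ C₄ := by rw [hC₄]; positivity
  -- T1
  have T1 : 9 * (A * Gb) * εC ≤ η / 10 := by
    rw [hεC]
    have := ChaosClosesEulerStressIsotropy.mul_div_add_one_le (x := 9 * (A * Gb)) (c := η / 10) (by positivity) (by positivity)
    calc 9 * (A * Gb) * (η / (10 * (9 * (A * Gb) + 1))) = 9 * (A * Gb) * (η / 10 / (9 * (A * Gb) + 1)) := by
          rw [div_div]
      _ ≤ η / 10 := this
  -- T3
  have T3 : 9 * (A * εP) ≤ η / 10 := by
    rw [hεP]
    have := ChaosClosesEulerStressIsotropy.mul_div_add_one_le (x := 9 * A) (c := η / 10) (by positivity) (by positivity)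
    calc 9 * (A * (η / (10 * (9 * A + 1)))) = 9 * A * (η / 10 / (9 * A + 1)) := by rw [div_div]; ring
      _ ≤ η / 10 := this
  -- T2, expanded: `18 ω εPl + 18 ω (t + 4r) C₁ + 72 A εPl + 324 A r C₁`
  have T2a : (18 * ω + 72 * A) * εPl ≤ η / 10 := by
    rw [hεPl]
    have := ChaosClosesEulerStressIsotropy.mul_div_add_one_le (x := 18 + 72 * A) (c := η / 10) (by positivity) (by positivity)
    calc (18 * ω + 72 * A) * (η / (10 * (18 + 72 * A + 1))) ≤ (18 + 72 * A) * (η / (10 * (18 + 72 * A + 1))) := by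
          apply mul_le_mul_of_nonneg_right _ (by positivity); nlinarith
      _ = (18 + 72 * A) * (η / 10 / (18 + 72 * A + 1)) := by rw [div_div]
      _ ≤ η / 10 := this
  have T2b : 18 * ω * ((t + 4 * r) * C₁) ≤ η / 10 := by
    have h1 : (t + 4 * r) * C₁ ≤ (t + 2) * C₁ := mul_le_mul_of_nonneg_right (by linarith) hC₁0
    have := ChaosClosesEulerStressIsotropy.mul_div_add_one_le (x := 18 * (t + 2) * C₁) (c := η / 10) (by positivity) (by positivity)
    calc 18 * ω * ((t + 4 * r) * C₁) ≤ 18 * ω * ((t + 2) * C₁) := mul_le_mul_of_nonneg_left h1 (by positivity)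
      _ = 18 * (t + 2) * C₁ * ω := by ring
      _ ≤ 18 * (t + 2) * C₁ * (η / (10 * (18 * (t + 2) * C₁ + 1))) := mul_le_mul_of_nonneg_left hωb (by positivity)
      _ = 18 * (t + 2) * C₁ * (η / 10 / (18 * (t + 2) * C₁ + 1)) := by rw [div_div]
      _ ≤ η / 10 := this
  have T2c : 324 * A * r * C₁ ≤ η / 20 := by
    have := ChaosClosesEulerStressIsotropy.mul_div_add_one_le (x := 324 * A * C₁) (c := η / 20) (by positivity) (by positivity)
    calc 324 * A * r * C₁ = 324 * A * C₁ * r := by ring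
      _ ≤ 324 * A * C₁ * (η / (20 * (324 * A * C₁ + 1))) := mul_le_mul_of_nonneg_left hrb (by positivity)
      _ = 324 * A * C₁ * (η / 20 / (324 * A * C₁ + 1)) := by rw [div_div]
      _ ≤ η / 20 := this
  -- T4
  have T4a : 9 * C₄ * (t + 1) * ω ≤ η / 20 := by
    have := ChaosClosesEulerStressIsotropy.mul_div_add_one_le (x := 9 * (C₄ * (t + 1))) (c := η / 20) (by positivity) (by positivity)
    calc 9 * C₄ * (t + 1) * ω ≤ 9 * C₄ * (t + 1) * (η / (20 * (9 * (C₄ * (t + 1)) + 1))) :=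
          mul_le_mul_of_nonneg_left hωb' (by positivity)
      _ = 9 * (C₄ * (t + 1)) * (η / 20 / (9 * (C₄ * (t + 1)) + 1)) := by rw [div_div]; ring
      _ ≤ η / 20 := this
  have T4b : 54 * A * C₄ * r ≤ η / 20 := by
    have := ChaosClosesEulerStressIsotropy.mul_div_add_one_le (x := 54 * A * C₄) (c := η / 20) (by positivity) (by positivity)
    calc 54 * A * C₄ * r ≤ 54 * A * C₄ * (η / (20 * (54 * A * C₄ + 1))) := mul_le_mul_of_nonneg_left hrb' (by positivity)
      _ = 54 * A * C₄ * (η / 20 / (54 * A * C₄ + 1)) := by rw [div_div]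
      _ ≤ η / 20 := this
  -- T5
  have T5 : 120 * Real.pi * A * CgY * η₀ * κ ≤ η / 10 := by
    rw [hκ]
    have := ChaosClosesEulerStressIsotropy.mul_div_add_one_le (x := 48 * (CgY * η₀) * (2 * A)) (c := η / 10 / 6) (by positivity) (by positivity)
    have h2 : 120 * Real.pi * A * CgY * η₀ ≤ 5 * (48 * (CgY * η₀) * (2 * A)) := by
      calc 120 * Real.pi * A * CgY * η₀ = (120 * Real.pi) * (A * CgY * η₀) := by ring
        _ ≤ 480 * (A * CgY * η₀) := mul_le_mul_of_nonneg_right (by linarith) (by positivity)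
        _ = 5 * (48 * (CgY * η₀) * (2 * A)) := by ring
    calc 120 * Real.pi * A * CgY * η₀ * (η / 10 / (6 * (48 * (CgY * η₀) * (2 * A) + 1)))
        ≤ 5 * (48 * (CgY * η₀) * (2 * A)) * (η / 10 / (6 * (48 * (CgY * η₀) * (2 * A) + 1))) :=
          mul_le_mul_of_nonneg_right h2 (by positivity)
      _ = 5 * ((48 * (CgY * η₀) * (2 * A)) * (η / 10 / 6 / (48 * (CgY * η₀) * (2 * A) + 1))) := by
          rw [div_div (η / 10)]; ring
      _ ≤ 5 * (η / 10 / 6) := mul_le_mul_of_nonneg_left this (by norm_num)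
      _ ≤ η / 10 := by linarith
  -- T6
  have T6 : 8 * Real.pi / 15 * (45 * (CgY * η₀) * (2 * A) * t *
      (2 * θ₁ + ρ₁ * Θ + (4 * L ^ 2 / (9 * Θ) + 8 * L ^ 2 / (3 * U ^ 2)) * K) +
      48 * (CgY * η₀) * (2 * A) * κ + 18 * (2 * A) * η') ≤ η / 4 := by
    have h0 : 8 * Real.pi / 15 ≤ 5 / 2 := by linarith
    by_cases hs : 0 ≤ 45 * (CgY * η₀) * (2 * A) * t *
        (2 * θ₁ + ρ₁ * Θ + (4 * L ^ 2 / (9 * Θ) + 8 * L ^ 2 / (3 * U ^ 2)) * K) +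
        48 * (CgY * η₀) * (2 * A) * κ + 18 * (2 * A) * η'
    · calc _ ≤ 5 / 2 * (η / 10) := mul_le_mul h0 h6 hs (by norm_num)
        _ = η / 4 := by ring
    · push Not at hs
      have : 8 * Real.pi / 15 * (45 * (CgY * η₀) * (2 * A) * t *
          (2 * θ₁ + ρ₁ * Θ + (4 * L ^ 2 / (9 * Θ) + 8 * L ^ 2 / (3 * U ^ 2)) * K) +
          48 * (CgY * η₀) * (2 * A) * κ + 18 * (2 * A) * η') ≤ 0 :=
        mul_nonpos_of_nonneg_of_nonpos (by positivity) hs.le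
      linarith
  -- the expansion of T2 and T4
  have e2 : 9 * (ω * (2 * (εPl + (t + 4 * r) * C₁)) +
      2 * A * (2 * (εPl + 4 * r * C₁) + 2 * (εPl + 5 * r * C₁))) =
      (18 * ω + 72 * A) * εPl + 18 * ω * ((t + 4 * r) * C₁) + 324 * A * r * C₁ := by ring
  have e4 : 9 * (C₄ * (ω * (t + 1) + 6 * A * r)) = 9 * C₄ * (t + 1) * ω + 54 * A * C₄ * r := by ring
  rw [e2, e4]
  linarith

end Budget

section Events

open Summit.AtomisticToContinuum.HydrodynamicLimit.Theorems.ChaosClosesEulerStressIsotropy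

/-- **The windowed cubic-tail event** from the fixed-time cubic tails (Tonelli along the window and Markov).
[folklore] -/
theorem cubeTail_window_event_le {σ : ℝ} {N : ℕ} (Φ : HardSphereFlow (Torus.geometry (Fin 3)) (hsDiameter σ N) (N + 1))
    {P : Measure (Phase N)} [SFinite P] (hP : P Φ.goodᶜ = 0) {t : ℝ} (ht : 0 ≤ t) {L M₀ : ℝ} (hM₀L : M₀ ≤ L)
    {e κ : ℝ} (he : 0 ≤ e) (hκ : 0 < κ)
    (hC : ∀ s ∈ Set.Icc 0 t, ∫⁻ z, ENNReal.ofReal (((N : ℝ) + 1)⁻¹ * ∑ i : Fin (N + 1),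
      Set.indicator {v : V3 | M₀ < ‖v‖} (fun v => ‖v‖ ^ 3) ((Φ.flow s z i).2)) ∂P ≤ ENNReal.ofReal e) :
    P {z | κ < ∫ s in (0 : ℝ)..t, ((N : ℝ) + 1)⁻¹ * ∑ i, cubeTail L ((Φ.flow s z) i).2} ≤
      ENNReal.ofReal (t * e / κ) := by
  have hf0 : ∀ w : Phase N, 0 ≤ ((N : ℝ) + 1)⁻¹ * ∑ i, cubeTail L (w i).2 := fun w =>
    mul_nonneg (by positivity) (Finset.sum_nonneg fun i _ => cubeTail_nonneg L _)
  have h1 := ChaosClosesEulerReadout.measure_lt_intervalIntegral_flow_le Φ hP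
    (f := fun w : Phase N => ((N : ℝ) + 1)⁻¹ * ∑ i, cubeTail L (w i).2) (measurable_mean_cubeTail L) hf0
    (fun z hz a b hab => intervalIntegrable_mean_cubeTail Φ L hz hab) ht he
    (fun s hs => by
      refine le_trans (lintegral_mono fun z => ENNReal.ofReal_le_ofReal ?_) (hC s ⟨hs.1.le, hs.2⟩)
      refine mul_le_mul_of_nonneg_left (Finset.sum_le_sum fun i _ => ?_) (by positivity)
      exact cubeTail_antitone hM₀L _) hκ
  rw [sub_zero] at h1
  exact h1

end Events

/-! ## Registered sub-goal -/

/-- **Registered sub-goal `stub_pressureValueN` (helper N of `stub_pressureValueOfEnskog`): the time clamp is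
`1`-Lipschitz.** [folklore] -/
theorem stub_pressureValueN : ∀ (t s t₀ : ℝ), |min (max s 0) (t + 1) - min (max t₀ 0) (t + 1)| ≤ |s - t₀| :=
  fun t s t₀ => abs_clamp_sub_clamp_le t s t₀

end Summit.AtomisticToContinuum.HydrodynamicLimit.Theorems.ChaosClosesEulerPressureValue

end
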